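import Mathlib
import Summits.CriticalPhenomena.CardyFormulaZ2.Theorems.CardyMagicRigidityDefs
import Literature.Probability.Percolation.FKLoopNestingMeasurable
import HarnessLib

/-!
# Measurability of the tower and pattern counts (line `ring-cloud-tomography`, crux `NestingRigidity`)

Crux `Summit.CriticalPhenomena.CardyFormulaZ2.Theses.CardyMagicRigidity.NestingRigidity`
(stmt-CriticalPhenomena-4835), line `ring-cloud-tomography`, helper toward stub
`stub_towerPressureFamily : TowerPressureFamily` (S2).

The tower moment `E.towerMoment u δ ρ = ∫ ω, u ^ towerCount (E.X δ ω) 0 ρ 1 ∂E.P` is a Bochner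
integral, so every estimate on it starts with the measurability of the integer-valued random variable
`ω ↦ towerCount (E.X δ ω) x ρ R` on both lattice ensembles. This file proves it:

* §1 a general lemma: if the random set of loops is the image `f '' S ω` of a random subset `S ω` of a
  COUNTABLE index type with measurable membership events, then `ω ↦ (f '' S ω).ncard` and
  `ω ↦ {u ∈ f '' S ω | Q u}.ncard` (any deterministic predicate `Q`) are measurable — the fibre
  `{ncard = n}` is a countable Boolean combination of membership events (`ncard_image_eq_iff`,
  quantifying over the countably many finite index sets);
* §2 both lattice loop configurations have this form (`loops_tEns_eq_image`: closed honeycomb walks,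
  `gen_siteLoopConfig`; `loops_zEns_eq_image`: nonempty medial dart lists, `mem_loops_iff`), whence
  `measurable_towerCount` (registered sub-goal) and `measurable_patternCount` for both members of
  `latticeEnsembles`, and the integrability of `u ^ towerCount` for `0 ≤ u ≤ 1`
  (`integrable_pow_towerCount`).
-/

noncomputable section

open MeasureTheory Set Filter Metric
open scoped Real Topology BigOperators

namespace Summit.CriticalPhenomena.CardyFormulaZ2.Cruxes.NestingRigidity.RingCloudTomography

open Literature.Probability.RandomPlanarGeometry Literature.Probability.Percolation
  Literature.Probability.LatticeModels

/-! ## §1 Counting the image of a random subset of a countable index type -/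

section General

variable {Ω K α : Type*} [MeasurableSpace Ω]

/-- The fibres of `S ↦ (f '' S).ncard` described by quantification over FINITE index sets: the image
has `n` elements iff some finite `T ⊆ S` has an `n`-element image covering `f '' S`, or `n = 0` and no
finite `T ⊆ S` covers (the image is infinite, `Set.Infinite.ncard`). -/
theorem ncard_image_eq_iff [DecidableEq α] (f : K → α) (S : Set K) (n : ℕ) :
    (f '' S).ncard = n ↔
      (∃ T : Finset K, (∀ k, k ∈ T → k ∈ S) ∧ (∀ k, k ∈ S → f k ∈ T.image f) ∧
          (T.image f).card = n) ∨
        (n = 0 ∧ ∀ T : Finset K, (∀ k, k ∈ T → k ∈ S) → ∃ k, k ∈ S ∧ f k ∉ T.image f) := by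
  -- a finite covering index set pins the image down
  have key : ∀ T : Finset K, (∀ k, k ∈ T → k ∈ S) → (∀ k, k ∈ S → f k ∈ T.image f) →
      f '' S = ↑(T.image f) := by
    intro T hTS hcov
    refine Set.Subset.antisymm ?_ ?_
    · rintro _ ⟨k, hk, rfl⟩
      exact Finset.mem_coe.2 (hcov k hk)
    · rw [Finset.coe_image]
      exact Set.image_mono fun k hk ↦ hTS k (Finset.mem_coe.1 hk)
  by_cases hfin : (f '' S).Finite
  · obtain ⟨s', hs'S, hbij⟩ := Set.exists_subset_bijOn S f
    have hs'fin : s'.Finite := hbij.finite_iff_finite.mpr hfin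
    have hT₀S : ∀ k, k ∈ hs'fin.toFinset → k ∈ S := fun k hk ↦
      hs'S ((Set.Finite.mem_toFinset hs'fin).1 hk)
    have himg : f '' S = ↑(hs'fin.toFinset.image f) := by
      rw [Finset.coe_image, hs'fin.coe_toFinset, hbij.image_eq]
    have hcov₀ : ∀ k, k ∈ S → f k ∈ hs'fin.toFinset.image f := fun k hk ↦ by
      have h := Set.mem_image_of_mem f hk
      rw [himg] at h
      exact Finset.mem_coe.1 h
    constructor
    · rintro rfl
      exact Or.inl ⟨hs'fin.toFinset, hT₀S, hcov₀, by rw [himg, Set.ncard_coe_finset]⟩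
    · rintro (⟨T, hTS, hcov, rfl⟩ | ⟨rfl, hall⟩)
      · rw [key T hTS hcov, Set.ncard_coe_finset]
      · obtain ⟨k, hk, hnot⟩ := hall _ hT₀S
        exact absurd (hcov₀ k hk) hnot
  · rw [Set.Infinite.ncard hfin]
    constructor
    · rintro rfl
      refine Or.inr ⟨rfl, fun T hTS ↦ ?_⟩
      by_contra h
      simp only [not_exists, not_and, not_not] at h
      exact hfin ((key T hTS h).symm ▸ (T.image f).finite_toSet)
    · rintro (⟨T, hTS, hcov, -⟩ | ⟨rfl, -⟩)
      · exact absurd ((key T hTS hcov).symm ▸ (T.image f).finite_toSet) hfin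
      · rfl

/-- **Counting an image of a random subset of a countable index type is measurable**: if every
membership event `{ω | k ∈ S ω}` is measurable, so is `ω ↦ (f '' S ω).ncard` (fibres are countable
Boolean combinations of membership events, `ncard_image_eq_iff`). -/
theorem measurable_ncard_image [Countable K] (f : K → α) {S : Ω → Set K}
    (hS : ∀ k, Measurable fun ω ↦ k ∈ S ω) : Measurable fun ω ↦ (f '' S ω).ncard := by
  classical
  refine measurable_to_countable' fun n ↦ ?_
  have hfib : (fun ω ↦ (f '' S ω).ncard) ⁻¹' {n} =
      {ω | (∃ T : Finset K, (∀ k, k ∈ T → k ∈ S ω) ∧ (∀ k, k ∈ S ω → f k ∈ T.image f) ∧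
          (T.image f).card = n) ∨
        (n = 0 ∧ ∀ T : Finset K, (∀ k, k ∈ T → k ∈ S ω) → ∃ k, k ∈ S ω ∧ f k ∉ T.image f)} := by
    ext ω
    exact ncard_image_eq_iff f (S ω) n
  rw [hfib]
  refine Measurable.setOf (Measurable.or ?_ ?_)
  · refine Measurable.exists fun T ↦ Measurable.and ?_ (Measurable.and ?_ measurable_const)
    · exact Measurable.forall fun k ↦ measurable_const.imp (hS k)
    · exact Measurable.forall fun k ↦ (hS k).imp measurable_const
  · refine measurable_const.and (Measurable.forall fun T ↦ Measurable.imp ?_ ?_)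
    · exact Measurable.forall fun k ↦ measurable_const.imp (hS k)
    · exact Measurable.exists fun k ↦ (hS k).and measurable_const

/-- The same for the sub-count cut out by a deterministic predicate `Q` on the loops:
`{u ∈ f '' S ω | Q u} = f '' (S ω ∩ {k | Q (f k)})`. -/
theorem measurable_ncard_image_sep [Countable K] (f : K → α) {S : Ω → Set K}
    (hS : ∀ k, Measurable fun ω ↦ k ∈ S ω) (Q : α → Prop) :
    Measurable fun ω ↦ {u ∈ f '' S ω | Q u}.ncard := by
  have h : ∀ ω, {u ∈ f '' S ω | Q u} = f '' (S ω ∩ {k | Q (f k)}) := fun ω ↦ by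
    ext u
    constructor
    · rintro ⟨⟨k, hk, rfl⟩, hq⟩
      exact ⟨k, ⟨hk, hq⟩, rfl⟩
    · rintro ⟨k, ⟨hk, hq⟩, rfl⟩
      exact ⟨⟨k, hk, rfl⟩, hq⟩
  simp_rw [h]
  exact measurable_ncard_image f fun k ↦ (hS k).and measurable_const

end General

/-! ## §2 The two lattice ensembles -/

/-- The loops (both types) of `tEns` at mesh `δ` are the polylines of the site interface loops of the
configuration, indexed by the countable type of closed honeycomb walks (no auxiliary definition: the
index map is written as a lambda). -/
theorem loops_tEns_eq_image (δ : ℝ) (ω : SiteConfig (Site 2)) :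
    (tEns.X δ ω).loops = (fun k : Σ v : HexVertex, hexGraph.Walk v v ↦
      UnbasedLoop.mk (BasedLoop.mk (siteLoopCurve δ k.2) (isLoop_siteLoopCurve δ k.2))) ''
        {k | IsSiteInterfaceLoop ω k.2} := by
  ext u
  rw [LoopConfig.loops, Set.mem_union, show tEns.X δ ω = siteLoopConfig δ ω from rfl,
    gen_siteLoopConfig δ ω 0 u, gen_siteLoopConfig δ ω 1 u]
  constructor
  · rintro (⟨k, ⟨h, -⟩, hk⟩ | ⟨k, ⟨h, -⟩, hk⟩) <;> exact ⟨k, h, hk⟩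
  · rintro ⟨k, h, hk⟩
    by_cases hs : 0 < shoelace (k.2.support.map hexCenter)
    · exact Or.inr ⟨k, ⟨h, ⟨fun _ ↦ hs, fun _ ↦ rfl⟩⟩, hk⟩
    · exact Or.inl ⟨k, ⟨h, ⟨fun h0 ↦ absurd h0 (by decide), fun h' ↦ absurd h' hs⟩⟩, hk⟩

/-- The loops (both types) of `zEns` at mesh `δ` are the polylines of the bond interface loops of the
configuration, indexed by the countable type of nonempty medial dart lists (`mem_loops_iff`). -/
theorem loops_zEns_eq_image (δ : ℝ) (ω : BondConfig (Site 2)) :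
    (zEns.X δ ω).loops = (fun k : {γ : List MedialVertex // γ ≠ []} ↦
      UnbasedLoop.mk (BasedLoop.mk (loopCurve δ 0 k.1) (isLoop_loopCurve δ 0 k.2))) ''
        {k | IsInterfaceLoop ω k.1} := by
  ext u
  rw [LoopConfig.loops, show zEns.X δ ω = bondLoopConfig δ 0 ω from rfl, mem_loops_iff]
  rfl

/-- Membership of a fixed closed honeycomb walk in the random index set of `tEns` is measurable. -/
theorem measurable_mem_siteIndex (k : Σ v : HexVertex, hexGraph.Walk v v) :
    Measurable fun ω : SiteConfig (Site 2) ↦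
      k ∈ {k : Σ v : HexVertex, hexGraph.Walk v v | IsSiteInterfaceLoop ω k.2} :=
  measurable_isSiteInterfaceLoop k.2

/-- Membership of a fixed medial dart list in the random index set of `zEns` is measurable. -/
theorem measurable_mem_bondIndex (k : {γ : List MedialVertex // γ ≠ []}) :
    Measurable fun ω : BondConfig (Site 2) ↦
      k ∈ {k : {γ : List MedialVertex // γ ≠ []} | IsInterfaceLoop ω k.1} :=
  measurable_isInterfaceLoop k.1

/-- **The tower count is a measurable random variable on both lattice ensembles** (every centre,
inner radius and window). -/
theorem measurable_towerCount :
    ∀ E ∈ latticeEnsembles, ∀ (δ : ℝ) (x : ℂ) (ρ R : ℝ),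
      Measurable fun ω ↦ towerCount (E.X δ ω) x ρ R := by
  intro E hE δ x ρ R
  haveI := countable_sigma_hexLoop
  simp only [latticeEnsembles, Set.mem_insert_iff, Set.mem_singleton_iff] at hE
  rcases hE with rfl | rfl
  · simp_rw [towerCount, loops_zEns_eq_image]
    exact measurable_ncard_image_sep _ measurable_mem_bondIndex _
  · simp_rw [towerCount, loops_tEns_eq_image]
    exact measurable_ncard_image_sep _ measurable_mem_siteIndex _

/-- **The pattern counts are measurable random variables on both lattice ensembles** (every finite
disc family, window and index set). -/
theorem measurable_patternCount :
    ∀ E ∈ latticeEnsembles, ∀ (δ : ℝ) {n : ℕ} (z : Fin n → ℂ) (r : Fin n → ℝ) (R : ℝ)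
      (S : Finset (Fin n)), Measurable fun ω ↦ patternCount (E.X δ ω) z r R S := by
  intro E hE δ n z r R S
  haveI := countable_sigma_hexLoop
  simp only [latticeEnsembles, Set.mem_insert_iff, Set.mem_singleton_iff] at hE
  rcases hE with rfl | rfl
  · simp_rw [patternCount, loops_zEns_eq_image]
    exact measurable_ncard_image_sep _ measurable_mem_bondIndex _
  · simp_rw [patternCount, loops_tEns_eq_image]
    exact measurable_ncard_image_sep _ measurable_mem_siteIndex _

/-- For weights `0 ≤ u ≤ 1` the integrand `u ^ N_x(ρ, R)` of the tower moment is integrable on both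
lattice ensembles (measurable by `measurable_towerCount`, bounded by `1`, probability law). -/
theorem integrable_pow_towerCount :
    ∀ E ∈ latticeEnsembles, ∀ (u δ : ℝ) (x : ℂ) (ρ R : ℝ), 0 ≤ u → u ≤ 1 →
      Integrable (fun ω ↦ u ^ towerCount (E.X δ ω) x ρ R) E.P := by
  intro E hE u δ x ρ R hu0 hu1
  haveI : IsProbabilityMeasure E.P := by
    simp only [latticeEnsembles, Set.mem_insert_iff, Set.mem_singleton_iff] at hE
    rcases hE with rfl | rfl
    · exact instIsProbabilityMeasureBondPercolation (zdGraph 2) half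
    · exact instIsProbabilityMeasureTriSitePercolation half
  have hm : Measurable fun ω ↦ u ^ towerCount (E.X δ ω) x ρ R :=
    (measurable_towerCount E hE δ x ρ R).const_pow u
  refine Integrable.of_bound hm.aestronglyMeasurable 1 (Filter.Eventually.of_forall fun ω ↦ ?_)
  rw [Real.norm_eq_abs, abs_of_nonneg (pow_nonneg hu0 _)]
  exact pow_le_one₀ hu0 hu1

end Summit.CriticalPhenomena.CardyFormulaZ2.Cruxes.NestingRigidity.RingCloudTomography

end
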